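import Summits.QuantumFields.BalabanUV.Beta.SaddleInverse
import Summits.QuantumFields.BalabanUV.Beta.GAN24.BorderedFrameInverse

/-!
# Beta / SaddleInverseResidual — the KRAWCZYK FORM of kernel pairing (S4): `K_big · R = 1 + 𝓔` for the explicit pairing
# matrix `R` built from ARBITRARY approximate inverses of the Faddeev–Popov matrices, every block of `𝓔` carrying an FP residual;
# approximate right inverse ⇒ inverse; and the norm step `‖𝓔‖ ≤ 1/2 ⇒ ‖K_big⁻¹‖ ≤ 2‖R‖` (GAN24 `neumann` BY NAME)
# (β sub-cell, CAP lane «KERNEL ALGEBRA + EXPORT», lineage `b2b-balaban-beta-cap3`, gen 10; part 2 of `Beta/SaddleInverse`)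

`Beta/SaddleInverse` §1 inverts the saddle matrix `[[A, B♭], [B, 0]]` EXACTLY when `Vi = V⁻¹`, `Wi = Ṽ⁻¹` (`V = B N`, `Ṽ = L B♭`).
A certificate on a box of complex momenta cannot carry exact inverses of `V(q)`, `Ṽ(q)`; it carries FIXED (centre-of-box, float or
rational) matrices `Vi`, `Wi`.  This leaf records what the same block computation gives with NO inverse hypothesis at all:
* §1 `saddle_mul_pairingInv_eq` ∕ `saddle_mul_pairingInv_eq_one_add`: from ONLY `A N = 0` and `A G = 1 − Y L`,
  `[[A, B♭], [B, 0]] · pairingInv = 1 + 𝓔`, `𝓔 = pairingResidual = [[−Y (1 − Ṽ Wi) L, 0], [(1 − V Vi) B G (1 − B♭ Wi L), V Vi − 1]]`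
  — the (1,2) block vanishes identically and every other block is an FP residual `1 − Ṽ Wi`, `1 − V Vi` times EXPLICIT factors
  (`Y`, `L`, `B G (1 − B♭ Wi L)`); `pairingResidual_eq_zero` recovers §1 of part 1 at exact inverses.
* §2 `isUnit_det_of_mul_eq_one_add`, `inv_eq_mul_inv_of_mul_eq_one_add`: `K Ri = 1 + E` with `1 + E` invertible ⇒ `K` invertible and
  `K⁻¹ = Ri (1 + E)⁻¹` (any commutative ring).
* §3 `norm_inv_le_of_mul_eq_one_add` (over `ℂ`, Euclidean operator norm `Matrix.Norms.L2Operator`): `K Ri = 1 + E`, `‖E‖ ≤ 1/2` ⇒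
  `IsUnit K.det ∧ ‖K⁻¹‖ ≤ 2‖Ri‖`; the Neumann step is `GAN24.BorderedFrameInverse.neumann` (road P1-fibre, tree) used BY NAME with `C₀ = 1`
  — nothing re-proved.
Use (the lane's pricing note CAP-KERNEL §4.17): on a box of real momenta around `x_c` the certifying inequality is
`sup_box ‖𝓔(x)‖ ≤ 1/2` with `𝓔` EXPLICIT (trigonometric-rational entries and two fixed matrices) — no interval matrix inversion —
and the certified constant is `2 · sup_box ‖R(x)‖` with `R` explicit; its first-order box scale is set by the FP residual rates
`‖∂V · Vi‖`, `‖∂Ṽ · Wi‖` and the explicit multipliers `‖Y‖‖L‖`, `‖B G (1 − B♭ Wi L)‖`, not by `‖K_big⁻¹‖·‖∂K_big‖`.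

HONEST FRAMING.  Kernel algebra + one quoted norm step, [folklore] throughout.  This module proves NO bound on any object of the
cell, NO number of the β-function, NO statement about Bałaban's operators, NO instance for the concrete 408 × 408 matrices (engines'
business) and discharges NOTHING of `FlowStep.BetaPertH`; whether the box scale it enables is affordable is a PRICING question answered
by float diagnostics elsewhere (not certificates).  Discharging `BetaPertH` would make Bałaban's ultraviolet stability unconditional —
NOT the continuum limit and NOT the Clay problem.  0 `sorry`, 0 cite tags; imports `Beta/SaddleInverse` (part 1) and
`Beta/GAN24/BorderedFrameInverse` (for `neumann`) only.
-/

namespace Summit.QuantumFields.BalabanUV.Beta.SaddleInverse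

open Matrix

variable {R : Type*} [CommRing R]

/-! ## §1 Pairing RESIDUAL (Krawczyk form of S4): no inverse hypotheses, arbitrary `Vi`, `Wi` -/

section Residual

variable {n m k l : Type*} [Fintype n] [Fintype m] [Fintype k] [Fintype l] [DecidableEq n] [DecidableEq m] [DecidableEq l]

variable {A : Matrix n n R} {Bf : Matrix n m R} {B : Matrix m n R} {G : Matrix n n R} {N : Matrix n k R}
  {L : Matrix l n R} {Y : Matrix n l R}

/-- The PAIRING RESIDUAL `𝓔 = [[−Y (1 − (L B♭) Wi) L, 0], [(1 − (B N) Vi) B G (1 − B♭ Wi L), (B N) Vi − 1]]`: every block carries a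
factor `1 − Ṽ Wi` or `1 − V Vi` (`V = B N`, `Ṽ = L B♭`), so `𝓔 = 0` when `Vi`, `Wi` are exact inverses and `𝓔` is SMALL when they are
approximate (float ∕ centre-of-box) inverses. [folklore] -/
def pairingResidual (Bf : Matrix n m R) (B : Matrix m n R) (G : Matrix n n R) (N : Matrix n k R) (L : Matrix l n R)
    (Y : Matrix n l R) (Vi : Matrix k m R) (Wi : Matrix m l R) : Matrix (n ⊕ m) (n ⊕ m) R :=
  fromBlocks (-(Y * (1 - L * Bf * Wi) * L)) 0 ((1 - B * N * Vi) * B * G * (1 - Bf * Wi * L)) (B * N * Vi - 1)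

/-- PAIRING RESIDUAL IDENTITY: with ONLY the kernel identities `A N = 0`, `A G = 1 − Y L` and for ARBITRARY `Vi`, `Wi`,
`saddle · pairingInv = [[1 − Y (1 − L B♭ Wi) L, 0], [(1 − B N Vi) B G (1 − B♭ Wi L), B N Vi]]`. [folklore] -/
theorem saddle_mul_pairingInv_eq (hAN : A * N = 0) (hAG : A * G = 1 - Y * L) (Vi : Matrix k m R) (Wi : Matrix m l R) :
    saddle A Bf B * pairingInv Bf B G N L Vi Wi =
      fromBlocks (1 - Y * (1 - L * Bf * Wi) * L) 0 ((1 - B * N * Vi) * B * G * (1 - Bf * Wi * L)) (B * N * Vi) := by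
  rw [saddle, pairingInv, fromBlocks_multiply, fromBlocks_inj]
  have hP : A * (1 - N * Vi * B) = A := by
    rw [Matrix.mul_sub, Matrix.mul_one, ← Matrix.mul_assoc, ← Matrix.mul_assoc, hAN, Matrix.zero_mul,
      Matrix.zero_mul, sub_zero]
  have hB : B * (1 - N * Vi * B) = (1 - B * N * Vi) * B := by
    rw [Matrix.mul_sub, Matrix.mul_one, Matrix.sub_mul, Matrix.one_mul, Matrix.mul_assoc, Matrix.mul_assoc,
      ← Matrix.mul_assoc B N]
  refine ⟨?_, ?_, ?_, ?_⟩
  · rw [← Matrix.mul_assoc A, ← Matrix.mul_assoc A, hP, hAG]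
    simp only [Matrix.sub_mul, Matrix.mul_sub, Matrix.one_mul, Matrix.mul_one, Matrix.mul_assoc]
    abel
  · rw [← Matrix.mul_assoc, hAN, Matrix.zero_mul, Matrix.mul_zero, add_zero]
  · rw [Matrix.zero_mul, add_zero, ← Matrix.mul_assoc B, ← Matrix.mul_assoc B, hB]
  · rw [← Matrix.mul_assoc, Matrix.zero_mul, add_zero]

/-- … equivalently `saddle · pairingInv = 1 + 𝓔`. [folklore] -/
theorem saddle_mul_pairingInv_eq_one_add (hAN : A * N = 0) (hAG : A * G = 1 - Y * L) (Vi : Matrix k m R)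
    (Wi : Matrix m l R) :
    saddle A Bf B * pairingInv Bf B G N L Vi Wi = 1 + pairingResidual Bf B G N L Y Vi Wi := by
  rw [saddle_mul_pairingInv_eq hAN hAG, pairingResidual, ← fromBlocks_one, fromBlocks_add, fromBlocks_inj]
  exact ⟨sub_eq_add_neg _ _, (add_zero _).symm, (zero_add _).symm, (add_sub_cancel _ _).symm⟩

/-- At exact inverses the residual vanishes (consistency with §1). [folklore] -/
theorem pairingResidual_eq_zero {Vi : Matrix k m R} {Wi : Matrix m l R} (hV : B * N * Vi = 1) (hW : L * Bf * Wi = 1)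
    (G : Matrix n n R) (Y : Matrix n l R) :
    pairingResidual Bf B G N L Y Vi Wi = 0 := by
  rw [pairingResidual, hV, hW, sub_self, sub_self, Matrix.mul_zero, Matrix.zero_mul, neg_zero, Matrix.zero_mul,
    Matrix.zero_mul, Matrix.zero_mul, ← fromBlocks_zero]

end Residual

/-! ## §2 Approximate right inverse ⇒ inverse (pure algebra; the norm step is `GAN24.BorderedFrameInverse.neumann` by name) -/

section ApproxInverse

variable {n : Type*} [Fintype n] [DecidableEq n] {K Ri E : Matrix n n R}

/-- If `K Ri = 1 + E` with `1 + E` invertible then `K` is invertible … [folklore] -/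
theorem isUnit_det_of_mul_eq_one_add (h : K * Ri = 1 + E) (hE : IsUnit (1 + E).det) : IsUnit K.det := by
  have hd : (K * Ri).det = (1 + E).det := by rw [h]
  rw [det_mul] at hd
  exact isUnit_of_mul_isUnit_left (hd ▸ hE)

/-- … and `K⁻¹ = Ri (1 + E)⁻¹` (the preconditioner times the inverse of a near-identity). [folklore] -/
theorem inv_eq_mul_inv_of_mul_eq_one_add (h : K * Ri = 1 + E) (hE : IsUnit (1 + E).det) : K⁻¹ = Ri * (1 + E)⁻¹ := by
  have hK := isUnit_det_of_mul_eq_one_add h hE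
  calc K⁻¹ = K⁻¹ * (K * Ri) * (1 + E)⁻¹ := by rw [h, Matrix.mul_assoc, Matrix.mul_nonsing_inv _ hE, Matrix.mul_one]
    _ = Ri * (1 + E)⁻¹ := by rw [← Matrix.mul_assoc K⁻¹, Matrix.nonsing_inv_mul _ hK, Matrix.one_mul]

end ApproxInverse

/-! ## §3 The norm step over `ℂ` (Euclidean operator norm): `‖𝓔‖ ≤ 1/2 ⇒ ‖K⁻¹‖ ≤ 2‖Ri‖` -/

section NormStep

open scoped Matrix.Norms.L2Operator

variable {n : Type*} [Fintype n] [DecidableEq n]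

/-- PAIRING–KRAWCZYK NORM BOUND: if `K Ri = 1 + E` with `‖E‖ ≤ 1/2` (Euclidean operator norm) then `K` is invertible and
`‖K⁻¹‖ ≤ 2 ‖Ri‖`.  The Neumann step is `GAN24.BorderedFrameInverse.neumann` BY NAME (with `C₀ = 1`). [folklore] -/
theorem norm_inv_le_of_mul_eq_one_add {K Ri E : Matrix n n ℂ} (h : K * Ri = 1 + E) (hE : ‖E‖ ≤ 1 / 2) :
    IsUnit K.det ∧ ‖K⁻¹‖ ≤ 2 * ‖Ri‖ := by
  have h1 : ‖(1 : Matrix n n ℂ)‖ ≤ 1 := by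
    rw [← diagonal_one, l2_opNorm_diagonal]
    exact (pi_norm_le_iff_of_nonneg zero_le_one).mpr fun _ => by simp
  have hh : ‖E‖ * ‖(1 : Matrix n n ℂ)⁻¹‖ ≤ 1 / 2 := by
    rw [inv_one]
    calc ‖E‖ * ‖(1 : Matrix n n ℂ)‖ ≤ ‖E‖ * 1 := mul_le_mul_of_nonneg_left h1 (norm_nonneg _)
      _ ≤ 1 / 2 := by rw [mul_one]; exact hE
  obtain ⟨hU, hN, -⟩ := GAN24.BorderedFrameInverse.neumann (isUnit_one (M := Matrix n n ℂ)) hh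
  have hE' : IsUnit (1 + E).det := (Matrix.isUnit_iff_isUnit_det _).1 hU
  refine ⟨isUnit_det_of_mul_eq_one_add h hE', ?_⟩
  rw [inv_eq_mul_inv_of_mul_eq_one_add h hE']
  calc ‖Ri * (1 + E)⁻¹‖ ≤ ‖Ri‖ * ‖(1 + E)⁻¹‖ := l2_opNorm_mul _ _
    _ ≤ ‖Ri‖ * (2 * ‖(1 : Matrix n n ℂ)⁻¹‖) := mul_le_mul_of_nonneg_left hN (norm_nonneg _)
    _ ≤ ‖Ri‖ * (2 * 1) := by rw [inv_one]; gcongr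
    _ = 2 * ‖Ri‖ := by ring

end NormStep

end Summit.QuantumFields.BalabanUV.Beta.SaddleInverse
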